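import Summits.NavierStokesRegularity.NavierStokesRegularity.Theorems.RellichScarScarRigidityBiotSavartExpansion
import Summits.NavierStokesRegularity.NavierStokesRegularity.Theorems.RellichScarScarRigidityBiotSavartLaplacian
import Summits.NavierStokesRegularity.NavierStokesRegularity.Theorems.RellichScarScarRigidityBiotSavartVorticity
import Summits.NavierStokesRegularity.NavierStokesRegularity.Theorems.RellichScarScarRigidityCoulombBounds
import Literature.Analysis.FluidPDE.HarmonicVanishing
import Literature.Analysis.FluidPDE.HarmonicLiouvilleLp
import HarnessLib

/-!
# `ScarRigidity`, line `moment-conditioned-rellich` — stub `stub_biotSavartFarField` (BS):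
# far field of a divergence-free field from its flat vorticity

Crux stmt-NavierStokesRegularity-11717 (route RellichScar).  This file CLOSES the registered stub
`stub_biotSavartFarField` of the skeleton `Cruxes/ScarRigidity/Lines/moment_conditioned_rellich.lean` (lead a1, v4):
a smooth divergence-free field `w` on `ℝ³` with `‖∇ⁿw(y)‖ ≤ Lₙ/(‖y‖+a)^{1+n}`, whose antisymmetric gradient
`A_ij = ∂ᵢw_j − ∂ⱼw_i` obeys `‖∇ⁿA_ij(y)‖ ≤ Kₙa⁴/(‖y‖+a)^{6+n}` and has vanishing first moments, satisfies
`‖∇ᵏw(x)‖ ≤ K'a³/‖x‖^{4+k}` for `‖x‖ ≥ a`, with `K' = K'(K, k)` (uniform in `a` and `w`).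

Proof (parts 1–5 are the helper files `…BiotSavart{Kernel,Moments,Expansion,Laplacian,Vorticity}`):

1. `Δw_j = Σᵢ ∂ᵢA_ij` (`div w = 0`, part 4), so `F = Δw` is smooth with `‖DⁿF‖ ≤ 9K_{n+1}a⁴/(‖y‖+a)^{7+n}`;
2. **Liouville** (`eq_newtonPotential_laplacian`): `w − Γ ⋆ Δw` is harmonic (`stub_newtonPotentialPoisson`) and tends
   to `0` at infinity (`stub_newtonPotentialDecay`, `‖w‖ ≤ L₀/(‖y‖+a)`), hence vanishes
   (`harmonic_eq_zero_of_tendsto_cocompact'`): `w = Γ ⋆ Δw`;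
3. the moments of `F` of order `≤ 2` vanish (part 5: `∫ ∂ᵢA_ij = 0`; `∫ y_l ∂ᵢA_ij = −δ_il ∫ A_ij` and
   **`∫ A = 0`** by the cyclic identity; `∫ y_l y_n ∂ᵢA_ij = −δ_il∫ y_nA_ij − δ_in∫ y_lA_ij = 0` by hypothesis);
4. the far-field expansion of `Γ ⋆ F` with vanishing moments (part 3) gives `‖Dᵏw(x)‖ ≤ C N a³/‖x‖^{4+k}` with
   `N = 9(|K₁| + |K_{k+1}|)`.
-/

noncomputable section

open Set Filter Function MeasureTheory Metric TopologicalSpace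
open scoped Topology ENNReal NNReal InnerProductSpace RealInnerProductSpace Laplacian ContDiff
open Literature.Analysis.FluidPDE

set_option linter.dupNamespace false -- D-0017: `Summit.<S>.<S>.…` repeats the summit name by design

-- nested operator types (`ℝ³ →L[ℝ] ℝ³ →L[ℝ] ℝ³`)
set_option maxSynthPendingDepth 4

namespace Summit.NavierStokesRegularity.NavierStokesRegularity.Theorems.RellichScarScarRigidity

/-- Physical space (the notation of the skeleton `Cruxes/ScarRigidity/Lines/moment_conditioned_rellich.lean`). -/
local notation "ℝ³" => EuclideanSpace ℝ (Fin 3)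

/-! ### Liouville: a decaying field is the Newtonian potential of its Laplacian -/

/-- **`w = Γ ⋆ Δw`** for a smooth field `w : ℝ³ → ℝ³` with `‖w(y)‖ ≤ L₀/(‖y‖+a)` and
`‖Δw(y)‖ ≤ A/(‖y‖+a)³` (`a > 0`): `w − Γ ⋆ Δw` is harmonic on `ℝ³` (Poisson's equation for the potential of
an apex density) and tends to zero at infinity, hence vanishes. [folklore] -/
theorem eq_newtonPotential_laplacian {w : ℝ³ → ℝ³} (hw : ContDiff ℝ (⊤ : ℕ∞) w) {L₀ A a : ℝ} (ha : 0 < a)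
    (hA : 0 ≤ A) (hw0 : ∀ y, ‖w y‖ ≤ L₀ / (‖y‖ + a)) (hΔ : ∀ y, ‖Δ w y‖ ≤ A * ((‖y‖ + a) ^ 3)⁻¹) (x : ℝ³) :
    w x = ∫ y, newtonKernel (x - y) • Δ w y := by
  have hw2 : ContDiff ℝ 2 w := contDiff_infty.1 hw 2
  have hΔs : ContDiff ℝ (⊤ : ℕ∞) (Δ w) := contDiff_laplacian (n := ⊤) hw
  have hΔ2 : ContDiff ℝ 2 (Δ w) := contDiff_infty.1 hΔs 2
  obtain ⟨hψ2, hψΔ⟩ := stub_newtonPotentialPoisson (Δ w) A a hΔ2 ha hA hΔ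
  obtain ⟨Kd, hKd0, hKd⟩ := stub_newtonPotentialDecay
  -- `w - ψ` is harmonic
  have hh2 : ContDiff ℝ 2 (w - fun x => ∫ y, newtonKernel (x - y) • Δ w y) := hw2.sub hψ2
  have hhΔ : ∀ x, Δ (w - fun x => ∫ y, newtonKernel (x - y) • Δ w y) x = 0 := fun x => by
    rw [ContDiffAt.laplacian_sub hw2.contDiffAt hψ2.contDiffAt, hψΔ x, sub_self]
  have hharm := harmonicOnNhd_of_laplacian_eq_zero hh2 hhΔ
  -- and tends to zero at infinity
  have hnorm : Tendsto (fun x : ℝ³ => ‖x‖) (cocompact ℝ³) atTop := tendsto_norm_cocompact_atTop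
  have hb : Tendsto (fun r : ℝ => L₀ * (r + a)⁻¹ + Kd * A * a ^ (-(1 / 4 : ℝ)) * r ^ (-(3 / 4 : ℝ))) atTop (𝓝 0) := by
    have h1 : Tendsto (fun r : ℝ => L₀ * (r + a)⁻¹) atTop (𝓝 0) := by
      have := (tendsto_inv_atTop_zero.comp (tendsto_atTop_add_const_right atTop a tendsto_id)).const_mul L₀
      simpa using this
    have h2 : Tendsto (fun r : ℝ => Kd * A * a ^ (-(1 / 4 : ℝ)) * r ^ (-(3 / 4 : ℝ))) atTop (𝓝 0) := by
      have := (tendsto_rpow_neg_atTop (by norm_num : (0 : ℝ) < 3 / 4)).const_mul (Kd * A * a ^ (-(1 / 4 : ℝ)))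
      simpa using this
    simpa using h1.add h2
  have hlim : Tendsto (w - fun x => ∫ y, newtonKernel (x - y) • Δ w y) (cocompact ℝ³) (𝓝 0) := by
    rw [tendsto_zero_iff_norm_tendsto_zero]
    refine squeeze_zero_norm' ?_ (hb.comp hnorm)
    filter_upwards [hnorm.eventually (eventually_gt_atTop 0)] with x hx
    have hx0 : x ≠ 0 := norm_pos_iff.1 hx
    rw [norm_norm, Pi.sub_apply, Function.comp_apply]
    calc ‖w x - ∫ y, newtonKernel (x - y) • Δ w y‖ ≤ ‖w x‖ + ‖∫ y, newtonKernel (x - y) • Δ w y‖ :=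
          norm_sub_le _ _
      _ ≤ L₀ / (‖x‖ + a) + ∫ y, ‖newtonKernel (x - y) • Δ w y‖ :=
          add_le_add (hw0 x) (norm_integral_le_integral_norm _)
      _ ≤ L₀ * (‖x‖ + a)⁻¹ + Kd * A * a ^ (-(1 / 4 : ℝ)) * ‖x‖ ^ (-(3 / 4 : ℝ)) := by
          rw [div_eq_mul_inv]
          exact add_le_add le_rfl (hKd a A ha hA (Δ w) hΔ x hx0)
  have h0 := congr_fun (harmonic_eq_zero_of_tendsto_cocompact' hharm hlim) x
  rw [Pi.sub_apply, Pi.zero_apply, sub_eq_zero] at h0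
  exact h0

/-! ### The moments of `Δw` -/

/-- **The moments of order `≤ 2` of `Δw` vanish** for a smooth divergence-free field whose antisymmetric
gradient is sextically flat with vanishing first moments (part 5 applied to `A_ij = ∂ᵢw_j − ∂ⱼw_i`, through
`(Δw)_j = Σᵢ ∂ᵢA_ij`). [folklore] -/
theorem laplacian_moments_eq_zero {w : ℝ³ → ℝ³} (hw : ContDiff ℝ (⊤ : ℕ∞) w) (hdiv : VectorCalculus.IsDivFree w)
    {K : ℕ → ℝ} {a N : ℝ} (ha : 0 < a)
    (hK : ∀ (n : ℕ) (i j : Fin 3) (y : ℝ³),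
      ‖iteratedFDeriv ℝ n (fun z : ℝ³ =>
          (fderiv ℝ w z (EuclideanSpace.single i (1 : ℝ))) j -
          (fderiv ℝ w z (EuclideanSpace.single j (1 : ℝ))) i) y‖ ≤ K n * a ^ 4 / (‖y‖ + a) ^ (6 + n))
    (hmom : ∀ (m i j : Fin 3),
      Integrable (fun y : ℝ³ => y m *
          ((fderiv ℝ w y (EuclideanSpace.single i (1 : ℝ))) j -
           (fderiv ℝ w y (EuclideanSpace.single j (1 : ℝ))) i)) volume ∧
      ∫ y : ℝ³, y m *
          ((fderiv ℝ w y (EuclideanSpace.single i (1 : ℝ))) j -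
           (fderiv ℝ w y (EuclideanSpace.single j (1 : ℝ))) i) = 0)
    (hF0 : ∀ y, ‖Δ w y‖ ≤ N * a ^ 4 / (‖y‖ + a) ^ 7) :
    (∫ y, Δ w y = 0) ∧ (∀ l : Fin 3, ∫ y : ℝ³, (y l) • Δ w y = 0) ∧
      ∀ l n : Fin 3, ∫ y : ℝ³, (y l * y n) • Δ w y = 0 := by
  have hw2 : ContDiff ℝ 2 w := contDiff_infty.1 hw 2
  -- the abstract matrix field of part 5
  set A : Fin 3 → Fin 3 → ℝ³ → ℝ := fun i j z =>
    (fderiv ℝ w z (EuclideanSpace.single i (1 : ℝ))) j - (fderiv ℝ w z (EuclideanSpace.single j (1 : ℝ))) i with hAd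
  have hAc : ∀ i j, ContDiff ℝ 1 (A i j) := fun i j => contDiff_antisymGrad (n := 1) (contDiff_infty.1 hw 2) i j
  have hA0 : ∀ i j y, ‖A i j y‖ ≤ K 0 * a ^ 4 / (‖y‖ + a) ^ 6 := fun i j y => by
    have h := hK 0 i j y
    rwa [norm_iteratedFDeriv_zero] at h
  have hA1 : ∀ i j y, ‖fderiv ℝ (A i j) y‖ ≤ K 1 * a ^ 4 / (‖y‖ + a) ^ 7 := fun i j y => by
    have h := hK 1 i j y
    rwa [norm_iteratedFDeriv_one] at h
  have hanti : ∀ i j y, A j i y = -A i j y := fun i j y => antisymGrad_swap i j y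
  have hcyc : ∀ (l m j : Fin 3) (y : ℝ³),
      fderiv ℝ (A m j) y (EuclideanSpace.single l (1 : ℝ)) + fderiv ℝ (A j l) y (EuclideanSpace.single m (1 : ℝ)) +
        fderiv ℝ (A l m) y (EuclideanSpace.single j (1 : ℝ)) = 0 := fun l m j y => antisymGrad_cyclic hw2 l m j y
  have hmom' : ∀ m i j : Fin 3, ∫ y : ℝ³, y m * A i j y = 0 := fun m i j => (hmom m i j).2
  have hcoord : ∀ (y : ℝ³) (j : Fin 3), (Δ w y) j = ∑ i : Fin 3, fderiv ℝ (A i j) y (EuclideanSpace.single i (1 : ℝ)) :=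
    fun y j => laplacian_coord_eq_sum_fderiv_antisymGrad hw2 hdiv y j
  -- integrability of the vector moments
  have hFc : Continuous (Δ w) := continuous_laplacian hw2
  have hFi : Integrable (Δ w) volume := integrable_of_apexBound_seven hFc ha hF0
  have h1i := integrable_coord_smul_of_apexBound_seven hFc ha hF0
  have h2i := integrable_coord_mul_coord_smul_of_apexBound_seven hFc ha hF0
  refine ⟨PiLp.ext fun j => ?_, fun l => PiLp.ext fun j => ?_, fun l n => PiLp.ext fun j => ?_⟩
  · have e := ((EuclideanSpace.proj j : ℝ³ →L[ℝ] ℝ).integral_comp_comm hFi).symm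
    refine (show (∫ y, Δ w y) j = ∫ y, (Δ w y) j from e).trans ?_
    simp_rw [hcoord]
    exact (integral_sum_fderiv_eq_zero hAc ha hA0 hA1 j).2
  · have e := ((EuclideanSpace.proj j : ℝ³ →L[ℝ] ℝ).integral_comp_comm (h1i l)).symm
    refine (show (∫ y : ℝ³, (y l) • Δ w y) j = ∫ y : ℝ³, ((y l) • Δ w y) j from e).trans ?_
    simp_rw [PiLp.smul_apply, smul_eq_mul, hcoord]
    exact (integral_coord_mul_sum_fderiv_eq_zero hAc ha hA0 hA1 hanti hcyc l j).2
  · have e := ((EuclideanSpace.proj j : ℝ³ →L[ℝ] ℝ).integral_comp_comm (h2i l n)).symm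
    refine (show (∫ y : ℝ³, (y l * y n) • Δ w y) j = ∫ y : ℝ³, ((y l * y n) • Δ w y) j from e).trans ?_
    simp_rw [PiLp.smul_apply, smul_eq_mul, hcoord]
    exact (integral_coord_mul_coord_mul_sum_fderiv_eq_zero hAc ha hA0 hA1 hmom' l n j).2

/-! ### The stub -/

/-- **BS — far field of a divergence-free field from its flat vorticity (single slice, scale `a`).**
A smooth divergence-free field `w` on `ℝ³` with `‖∇ⁿw(y)‖ ≤ Lₙ/(‖y‖+a)^{1+n}`, whose antisymmetric gradient
`A_ij = ∂_iw_j − ∂_jw_i` obeys `‖∇ⁿA_ij(y)‖ ≤ Kₙa⁴/(‖y‖+a)^{6+n}` and has vanishing first moments, satisfies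
`‖∇ᵏw(x)‖ ≤ K'a³/‖x‖^{4+k}` for `‖x‖ ≥ a`, with `K'` depending only on `K`, `k` (not on `a`, `w`, nor `L`).
Mechanism: `Δw_j = ∂_iA_ij`, `w = Γ ⋆ Δw` (Liouville for the decaying harmonic difference), and the far-field
expansion of the Newtonian potential of a density with vanishing moments of order `≤ 2` (`∫ ∂ᵢA_ij = 0`,
`∫ A = 0` by the cyclic identity, `∫ y A = 0` by hypothesis). [folklore; Stein, *Singular Integrals* III §3] -/
theorem stub_biotSavartFarField :
    ∀ (L K : ℕ → ℝ) (k : ℕ), ∃ K' : ℝ, ∀ (a : ℝ), 0 < a → ∀ (w : ℝ³ → ℝ³),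
      ContDiff ℝ (⊤ : ℕ∞) w → VectorCalculus.IsDivFree w →
      (∀ (n : ℕ) (y : ℝ³), ‖iteratedFDeriv ℝ n w y‖ ≤ L n / (‖y‖ + a) ^ (1 + n)) →
      (∀ (n : ℕ) (i j : Fin 3) (y : ℝ³),
        ‖iteratedFDeriv ℝ n (fun z : ℝ³ =>
            (fderiv ℝ w z (EuclideanSpace.single i (1 : ℝ))) j -
            (fderiv ℝ w z (EuclideanSpace.single j (1 : ℝ))) i) y‖ ≤ K n * a ^ 4 / (‖y‖ + a) ^ (6 + n)) →
      (∀ (m i j : Fin 3),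
        Integrable (fun y : ℝ³ => y m *
            ((fderiv ℝ w y (EuclideanSpace.single i (1 : ℝ))) j -
             (fderiv ℝ w y (EuclideanSpace.single j (1 : ℝ))) i)) volume ∧
        ∫ y : ℝ³, y m *
            ((fderiv ℝ w y (EuclideanSpace.single i (1 : ℝ))) j -
             (fderiv ℝ w y (EuclideanSpace.single j (1 : ℝ))) i) = 0) →
      ∀ x : ℝ³, a ≤ ‖x‖ → ‖iteratedFDeriv ℝ k w x‖ ≤ K' * a ^ 3 / ‖x‖ ^ (4 + k) := by
  intro L K k
  obtain ⟨C, hC0, hC⟩ := exists_farField_newtonPotential_bound k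
  refine ⟨C * (9 * (|K 1| + |K (k + 1)|)), fun a ha w hw hdiv hL hK hmom x hx => ?_⟩
  have hw2 : ContDiff ℝ 2 w := contDiff_infty.1 hw 2
  -- the density `F = Δw`
  have hF : ContDiff ℝ (⊤ : ℕ∞) (Δ w) := contDiff_laplacian (n := ⊤) hw
  have hFn : ∀ (n : ℕ) (y : ℝ³), ‖iteratedFDeriv ℝ n (Δ w) y‖ ≤ 9 * K (n + 1) * a ^ 4 / (‖y‖ + a) ^ (7 + n) := by
    intro n y
    refine (norm_iteratedFDeriv_laplacian_le_sum hw hdiv n y).trans ?_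
    have hterm : ∀ i j : Fin 3, ‖iteratedFDeriv ℝ (n + 1) (fun z : ℝ³ =>
        (fderiv ℝ w z (EuclideanSpace.single i (1 : ℝ))) j - (fderiv ℝ w z (EuclideanSpace.single j (1 : ℝ))) i) y‖ ≤
        K (n + 1) * a ^ 4 / (‖y‖ + a) ^ (7 + n) := by
      intro i j
      have h := hK (n + 1) i j y
      rwa [show 6 + (n + 1) = 7 + n by ring] at h
    calc _ ≤ ∑ _j : Fin 3, ∑ _i : Fin 3, K (n + 1) * a ^ 4 / (‖y‖ + a) ^ (7 + n) :=
          Finset.sum_le_sum fun j _ => Finset.sum_le_sum fun i _ => hterm i j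
      _ = 9 * K (n + 1) * a ^ 4 / (‖y‖ + a) ^ (7 + n) := by
          simp only [Finset.sum_const, Finset.card_univ, Fintype.card_fin, nsmul_eq_mul, Nat.cast_ofNat]
          ring
  have hup : ∀ (X : ℝ) {p : ℕ} (y : ℝ³), X ≤ |K 1| + |K (k + 1)| →
      9 * X * a ^ 4 / (‖y‖ + a) ^ p ≤ 9 * (|K 1| + |K (k + 1)|) * a ^ 4 / (‖y‖ + a) ^ p := by
    intro X p y hX
    exact div_le_div_of_nonneg_right (by nlinarith [pow_pos ha 4]) (by positivity)
  have hF0 : ∀ y, ‖Δ w y‖ ≤ 9 * (|K 1| + |K (k + 1)|) * a ^ 4 / (‖y‖ + a) ^ 7 := fun y => by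
    have h := hFn 0 y
    rw [norm_iteratedFDeriv_zero] at h
    exact h.trans (hup (K 1) y ((le_abs_self _).trans (le_add_of_nonneg_right (abs_nonneg _))))
  have hFk : ∀ y, ‖iteratedFDeriv ℝ k (Δ w) y‖ ≤ 9 * (|K 1| + |K (k + 1)|) * a ^ 4 / (‖y‖ + a) ^ (7 + k) :=
    fun y => (hFn k y).trans (hup (K (k + 1)) y ((le_abs_self _).trans (le_add_of_nonneg_left (abs_nonneg _))))
  -- Liouville: `w = Γ ⋆ Δw`
  have hL0 : ∀ y, ‖w y‖ ≤ L 0 / (‖y‖ + a) := fun y => by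
    have h := hL 0 y
    rwa [norm_iteratedFDeriv_zero, Nat.add_zero, pow_one] at h
  have hN0 : 0 ≤ 9 * (|K 1| + |K (k + 1)|) := by positivity
  have hΔ3 : ∀ y, ‖Δ w y‖ ≤ 9 * (|K 1| + |K (k + 1)|) * ((‖y‖ + a) ^ 3)⁻¹ := fun y => by
    refine (hF0 y).trans ?_
    have hρ : 0 < ‖y‖ + a := by positivity
    have haρ : a ^ 4 ≤ (‖y‖ + a) ^ 4 := pow_le_pow_left₀ ha.le (by linarith [norm_nonneg y]) 4
    calc 9 * (|K 1| + |K (k + 1)|) * a ^ 4 / (‖y‖ + a) ^ 7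
        ≤ 9 * (|K 1| + |K (k + 1)|) * (‖y‖ + a) ^ 4 / (‖y‖ + a) ^ 7 := by gcongr
      _ = 9 * (|K 1| + |K (k + 1)|) * ((‖y‖ + a) ^ 3)⁻¹ := by
          have hρ' : ‖y‖ + a ≠ 0 := hρ.ne'
          field_simp
  have hrep : w = fun x => ∫ y, newtonKernel (x - y) • Δ w y :=
    funext fun x => eq_newtonPotential_laplacian hw ha hN0 hL0 hΔ3 x
  obtain ⟨hM0, hM1, hM2⟩ := laplacian_moments_eq_zero hw hdiv ha hK hmom hF0
  have hmain := hC (Δ w) (9 * (|K 1| + |K (k + 1)|)) a x hF ha hx hF0 hFk hM0 hM1 hM2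
  rw [hrep]
  calc _ ≤ C * (9 * (|K 1| + |K (k + 1)|)) * a ^ 3 / ‖x‖ ^ (4 + k) := hmain
    _ = _ := by ring

end Summit.NavierStokesRegularity.NavierStokesRegularity.Theorems.RellichScarScarRigidity

end
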